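import Summits.NavierStokesRegularity.NavierStokesRegularity.Theses.QuarterLogPincer
import HarnessLib

/-!
# `QuarterLogPincer.SuperlogCubeRate` — registered stub `stub_cubeOfNorm` of the norm road
# (crux stmt-NavierStokesRegularity-23934, skeleton v2 `SuperlogCubeRate_birth.lean`)

**Statement.** `SuperlogTypeIRate → SuperlogCubeRate`: if at a non-extendable velocity-Type-I
blow-up the `L³` NORM beats every affine logarithm `C₁ + C₂ log(T/(T−t))`, then so does the `L³`
CUBE. Elementary: test the norm statement against the majorant `|C₁| + 1 + |C₂| log(T/(T−t)) ≥ 1`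
(the logarithm is nonnegative on `[0,T)`); at the produced time the norm exceeds `1`, hence
`‖u(t)‖₃ ≤ ‖u(t)‖₃³` in `ℝ≥0∞`, and the cube exceeds the original affine logarithm.

This is the third stub of the NORM-ROAD composition `stub_subexpQuantESS → stub_quantBridge →
stub_cubeOfNorm` of the skeleton registered on the item (the other road, `TypeIQuantSubcubicExp →
CubeBridge`, has `CubeBridge` closed, p591488). HONEST FRAMING: pure bookkeeping between two route
statements; `SuperlogTypeIRate` (stmt-23361) and `SuperlogCubeRate` (stmt-23934) both remain OPEN
(they sit on the backward-DSS wall), and nothing about Navier–Stokes regularity is proved here.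
-/

noncomputable section

set_option linter.dupNamespace false

namespace Summit.NavierStokesRegularity.NavierStokesRegularity.Theorems.SuperlogCubeRate.Birth

open MeasureTheory

/-- In `ℝ≥0∞`, an element exceeding `1` is at most its cube. -/
theorem le_pow_three_of_one_le {a : ENNReal} (ha : 1 ≤ a) : a ≤ a ^ (3 : ℕ) := by
  calc a = a * 1 * 1 := by simp
    _ ≤ a * a * a := by gcongr
    _ = a ^ (3 : ℕ) := by ring

/-- **Registered stub `stub_cubeOfNorm`** (crux stmt-NavierStokesRegularity-23934, norm road):
`SuperlogTypeIRate → SuperlogCubeRate` — a super-logarithmic `L³` norm at a velocity-Type-I blow-up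
gives a super-logarithmic `L³` cube (test the norm statement with the constants `|C₁| + 1, |C₂|`;
the affine logarithm is then `≥ 1`, so the norm exceeds `1` and is dominated by its cube). -/
theorem stub_cubeOfNorm :
    Summit.NavierStokesRegularity.NavierStokesRegularity.Theses.QuarterLogPincer.SuperlogTypeIRate →
      Summit.NavierStokesRegularity.NavierStokesRegularity.Theses.QuarterLogPincer.SuperlogCubeRate := by
  unfold Summit.NavierStokesRegularity.NavierStokesRegularity.Theses.QuarterLogPincer.SuperlogTypeIRate
    Summit.NavierStokesRegularity.NavierStokesRegularity.Theses.QuarterLogPincer.SuperlogCubeRate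
  intro h ν T hν hT u p hcl hLH hdec hnext htypeI C₁ C₂
  obtain ⟨t, ht, hlt⟩ := h ν T hν hT u p hcl hLH hdec hnext htypeI (|C₁| + 1) |C₂|
  refine ⟨t, ht, ?_⟩
  have ht0 : 0 ≤ t := ht.1
  have htT : t < T := ht.2
  have hlog : 0 ≤ Real.log (T / (T - t)) := by
    apply Real.log_nonneg
    rw [le_div_iff₀ (by linarith)]
    linarith
  have h1 : C₁ + C₂ * Real.log (T / (T - t)) ≤ |C₁| + 1 + |C₂| * Real.log (T / (T - t)) := by
    have ha : C₁ ≤ |C₁| := le_abs_self C₁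
    have hb : C₂ * Real.log (T / (T - t)) ≤ |C₂| * Real.log (T / (T - t)) :=
      mul_le_mul_of_nonneg_right (le_abs_self C₂) hlog
    linarith
  have hone : (1 : ENNReal) ≤ ENNReal.ofReal (|C₁| + 1 + |C₂| * Real.log (T / (T - t))) := by
    rw [← ENNReal.ofReal_one]
    apply ENNReal.ofReal_le_ofReal
    have : 0 ≤ |C₂| * Real.log (T / (T - t)) := mul_nonneg (abs_nonneg _) hlog
    have : 0 ≤ |C₁| := abs_nonneg _
    linarith
  have hnorm : 1 ≤ eLpNorm (u t) 3 volume := hone.trans hlt.le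
  calc ENNReal.ofReal (C₁ + C₂ * Real.log (T / (T - t)))
      ≤ ENNReal.ofReal (|C₁| + 1 + |C₂| * Real.log (T / (T - t))) := ENNReal.ofReal_le_ofReal h1
    _ < eLpNorm (u t) 3 volume := hlt
    _ ≤ eLpNorm (u t) 3 volume ^ (3 : ℕ) := le_pow_three_of_one_le hnorm

end Summit.NavierStokesRegularity.NavierStokesRegularity.Theorems.SuperlogCubeRate.Birth

end
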